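import Summits.BirchSwinnertonDyer.BirchSwinnertonDyer.Theorems.AdditiveKolyvaginRoadLevelDefs
import Mathlib.NumberTheory.Padics.PadicNumbers
import HarnessLib

/-!
# Sketch — crux-ideate r1 seat 2 g17, card `pointwise-klingen-seed` (crux KS′ 21396 ⟸ KPA′ 21400)

First lemma of the line (support S-vis): a 𝔭-VISIBLE even core level exists. At a ♯ frame (ρ̄ onto, p ≥ 5,
K imaginary quadratic, binder E(ℚ_p)[p] = 0, odd total canonical rank at level ∅) there is a non-empty EVEN set n₀ of Bertolini–Darmon
admissible primes of total canonical rank ONE whose non-zero level-n₀ Selmer classes are not locally trivial at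
the places above p. (Mazur–Rubin/Howard core-vertex theory for the structure «F(n) ∩ strict above p» + two-sign
Čebotarev, E-side, p-generic; cousin of the one-step visibility lemma (V) of card `visible-vertex-transfer`.)
Not proved here; it elaborates. BSD is not proved by this.
-/

set_option linter.dupNamespace false

noncomputable section

open scoped Classical

namespace Summit.BirchSwinnertonDyer.BirchSwinnertonDyer.Cruxes.LevelKolyvaginSystemsAdditive.PointwiseKlingenSeed

open WeierstrassCurve NumberField IsDedekindDomain Module
  Literature.NumberTheory.EllipticCurves Literature.NumberTheory.GaloisRepresentations
  Summit.BirchSwinnertonDyer.BirchSwinnertonDyer.Theorems.AdditiveKoly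

/-- **S-vis (support): a 𝔭-visible even core level exists.** For `c` complex conjugation and the `ZMod p`-structure
on `H¹(K, E[p])`: if the total canonical rank at level `∅` is odd, there is a non-empty even admissible level `n₀`
of total canonical rank `1` at which every non-zero class of `Sel_{n₀}^±` has NON-ZERO localisation at every place
above `p`. [cite: MazurRubin2004, Prop. 4.5.8, Lemma 4.1.7] [cite: Howard2006Bipartite, Cor. 2.3.5]
[cite: WZhang2014, Prop. 5.4, Lemma 7.3] -/
def VisibleEvenCoreLevel : Prop :=
  ∀ (W : WeierstrassCurve ℚ) [W.IsElliptic] [W.IsGloballyMinimal] (p : ℕ) [Fact p.Prime]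
    (K : Type) [Field K] [NumberField K],
    5 ≤ p → W.HasSurjectiveModNGaloisRep p → IsImaginaryQuadratic K →
    (∀ Q : (W.baseChange ℚ_[p]).toAffine.Point, (p : ℤ) • Q = 0 → Q = 0) →
    ∀ (c : K ≃ₐ[ℚ] K), c ≠ 1 → ∀ [Module (ZMod p) (Vp W K p)],
    Odd (finrank (ZMod p) (SelQP W K p c ∅ true) + finrank (ZMod p) (SelQP W K p c ∅ false)) →
    ∃ n₀ : Finset (AdmQ W K p), n₀.Nonempty ∧ Even n₀.card ∧
      finrank (ZMod p) (SelQP W K p c n₀ true) + finrank (ZMod p) (SelQP W K p c n₀ false) = 1 ∧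
      ∀ (μ : Bool) (x : Vp W K p), x ∈ SelQP W K p c n₀ μ → x ≠ 0 →
        ∀ v : HeightOneSpectrum (𝓞 K), ((p : ℕ) : 𝓞 K) ∈ v.asIdeal →
          x ∉ (W.baseChange K).torsionLocalKer (v.adicCompletion K) ((p ^ 1 : ℕ) : ℤ)

end Summit.BirchSwinnertonDyer.BirchSwinnertonDyer.Cruxes.LevelKolyvaginSystemsAdditive.PointwiseKlingenSeed

end
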